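import Summits.AtomisticToContinuum.Crystallization.Theorems.ExcessDecayLiouvillePhononStabilityDefs
import Summits.AtomisticToContinuum.Crystallization.Theorems.ExcessDecayLiouvillePhononStabilityWindow
import Summits.AtomisticToContinuum.Crystallization.Theorems.ExcessDecayLiouvillePhononStabilityTail

/-!
# Near-certificate layer VII: computable class enumeration, the far `|ω|` bound, nearest-neighbour chains

Support file for crux `PhononStability` (line `contragredient-window-collapse`): the integer quadratic form
`Q(c) = 36‖ζ⁰_c‖²`, the exact ranges `classesR R` as computable filtered boxes, the window bound
`|ω(‖Aζ_c(δ)‖)| ≤ U(Q(c))` for far classes with a rational `U`, and a computable greedy nearest-neighbour chain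
of every class (its validity is checked by evaluation where used, not proved). [folklore]
-/

noncomputable section

open scoped BigOperators Classical InnerProductSpace
open Filter Set Function
open Summit.AtomisticToContinuum.Crystallization.Theorems.PhononStabilityNegative

namespace Summit.AtomisticToContinuum.Crystallization.Theorems.PhononStabilityCWC.Cert

local notation "E3" => EuclideanSpace ℝ (Fin 3)

/-! ## The integer quadratic form of reference lengths -/

/-- integer sublattice sign -/
def subSignZ (m : Fin 2) : ℤ := if m = 1 then 1 else 0

/-- `Q(c) = 36‖ζ⁰_c‖²` as an integer: `9(2n₀+n₁+s)² + 3(3n₁+s)² + 24(2n₂+s)²`. [folklore] -/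
def Qint (c : BondClass) : ℤ :=
  9 * (2 * c.2.2 0 + c.2.2 1 + (subSignZ c.2.1 - subSignZ c.1)) ^ 2 +
    3 * (3 * c.2.2 1 + (subSignZ c.2.1 - subSignZ c.1)) ^ 2 +
      24 * (2 * c.2.2 2 + (subSignZ c.2.1 - subSignZ c.1)) ^ 2

/-- cast of the integer sign. [folklore] -/
theorem subSignZ_cast (m : Fin 2) : ((subSignZ m : ℤ) : ℝ) = subSign m := by
  unfold subSignZ subSign
  split_ifs <;> simp

/-- `Q(c) = 36‖ζ⁰_c‖²`. [folklore] -/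
theorem qint_cast (c : BondClass) : ((Qint c : ℤ) : ℝ) = 36 * ‖bondVec 0 c‖ ^ 2 := by
  obtain ⟨m, m', n⟩ := c
  rw [WindowStub.norm_sq_bondVec_zero]
  simp only [Qint]
  push_cast
  rw [subSignZ_cast, subSignZ_cast]

/-! ## Computable boxes and the exact ranges -/

/-- the computable box `|nᵢ| ≤ b` of classes -/
def boxFin (b : ℕ) : Finset BondClass :=
  Finset.univ ×ˢ (Finset.univ ×ˢ Fintype.piFinset fun _ : Fin 3 => Finset.Icc (-(b : ℤ)) (b : ℤ))

/-- `classBox R` is the computable box with `b = ⌈2R⌉₊ + 1`. [folklore] -/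
theorem classBox_eq {R : ℝ} {b : ℕ} (hb : ⌈2 * R⌉₊ + 1 = b) : classBox R = boxFin b := by
  unfold classBox boxFin
  subst hb
  push_cast
  rfl

/-- **Exact range by the integer form:** `classesR R = {c ∈ box | Q(c) ≤ q}` when `q = 36R²`. [folklore] -/
theorem classesR_eq {R : ℝ} {b : ℕ} {q : ℤ} (hb : ⌈2 * R⌉₊ + 1 = b) (hq : ((q : ℤ) : ℝ) = 36 * R ^ 2)
    (hR : 0 ≤ R) : classesR R = (boxFin b).filter fun c => Qint c ≤ q := by
  unfold classesR
  rw [classBox_eq hb]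
  ext c
  simp only [Finset.mem_filter, and_congr_right_iff]
  intro _
  rw [← @Int.cast_le ℝ, qint_cast, hq]
  constructor
  · intro h
    nlinarith [norm_nonneg (bondVec 0 c)]
  · intro h
    by_contra h'
    push Not at h'
    nlinarith [norm_nonneg (bondVec 0 c)]

/-- Membership in the exact range by the integer form. [folklore] -/
theorem mem_classesR_iff {R : ℝ} {b : ℕ} {q : ℤ} (hb : ⌈2 * R⌉₊ + 1 = b) (hq : ((q : ℤ) : ℝ) = 36 * R ^ 2)
    (hR : 0 ≤ R) (c : BondClass) : c ∈ classesR R ↔ c ∈ boxFin b ∧ Qint c ≤ q := by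
  rw [classesR_eq hb hq hR, Finset.mem_filter]

/-- A class of reference length `≤ R` lies in the box of `R`. [folklore] -/
theorem mem_boxFin_of_qint_le {R : ℝ} {b : ℕ} {q : ℤ} (hb : ⌈2 * R⌉₊ + 1 = b) (hq : ((q : ℤ) : ℝ) = 36 * R ^ 2)
    (hR : 0 ≤ R) {c : BondClass} (hc : Qint c ≤ q) : c ∈ boxFin b := by
  rw [← classBox_eq hb]
  refine TailStub.mem_classBox_of_norm_le ?_
  rw [← @Int.cast_le ℝ, qint_cast, hq] at hc
  nlinarith [norm_nonneg (bondVec 0 c)]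

/-! ## The far `|ω|` bound as a rational function of `Q(c)` -/

/-- `ζ_c(δ) = ζ⁰_c + (σ(m') − σ(m))·δ` (copy of the line's Basics lemma). [folklore] -/
theorem bondVec_eq (δ : E3) (c : BondClass) :
    bondVec δ c = bondVec 0 c + (subSign c.2.1 - subSign c.1) • δ := by
  have h : ∀ ℓ : Label, refPos δ ℓ = latVec ℓ.2 + subSign ℓ.1 • (innerRef + δ) := by
    intro ℓ; unfold refPos subSign; split_ifs <;> simp
  have h0 : ∀ ℓ : Label, refPos 0 ℓ = latVec ℓ.2 + subSign ℓ.1 • innerRef := by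
    intro ℓ; unfold refPos subSign; split_ifs <;> simp
  simp only [bondVec, h, h0, smul_add, sub_smul]
  abel

/-- `‖ζ_c(δ)‖ ≥ ‖ζ⁰_c‖ − 5/189` on the window. [folklore] -/
theorem norm_bondVec_ge {A : E3 →L[ℝ] E3} {δ : E3} (hW : CellWindow A) (hδ : ShiftWindow A δ) (c : BondClass) :
    ‖bondVec 0 c‖ - 5 / 189 ≤ ‖bondVec δ c‖ := by
  have hε : ‖δ‖ ≤ 5 / 189 := by
    have h1 := (hW δ).1
    unfold ShiftWindow at hδ
    linarith
  have hs : |subSign c.2.1 - subSign c.1| ≤ 1 := by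
    unfold subSign; split_ifs <;> norm_num
  have hb : ‖bondVec δ c - bondVec 0 c‖ ≤ ‖δ‖ := by
    rw [bondVec_eq δ c, add_sub_cancel_left, norm_smul, Real.norm_eq_abs]
    calc |subSign c.2.1 - subSign c.1| * ‖δ‖ ≤ 1 * ‖δ‖ := mul_le_mul_of_nonneg_right hs (norm_nonneg _)
      _ = ‖δ‖ := one_mul _
  have := norm_sub_norm_le (bondVec 0 c) (bondVec δ c)
  rw [norm_sub_rev] at hb
  linarith

/-- The scalar far bound: for `Q ≥ 144` and `r² ≥ (4347/5000)(Q/36)`,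
`|14 r⁻¹⁶ − 8 r⁻¹⁰| ≤ (1611/100)(36/Q)⁵`. [folklore] -/
theorem far_abs_scalar {Q r2 : ℝ} (hQ : 144 ≤ Q) (hr : 4347 / 5000 * (Q / 36) ≤ r2) :
    |14 * r2⁻¹ ^ 8 - 8 * r2⁻¹ ^ 5| ≤ 1611 / 100 * (36 / Q) ^ 5 := by
  have hQpos : 0 < Q := by linarith
  have hlow : 4347 / 5000 * (Q / 36) > 3 := by nlinarith
  have hr2 : 0 < r2 := by linarith
  set u := r2⁻¹ with hu
  have hupos : 0 < u := inv_pos.mpr hr2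
  have hule : u ≤ (4347 / 5000 * (Q / 36))⁻¹ := by
    rw [hu]; exact inv_anti₀ (by linarith) hr
  have hu1 : u ≤ 1 / 3 := by
    have : (4347 / 5000 * (Q / 36))⁻¹ ≤ (3 : ℝ)⁻¹ := inv_anti₀ (by norm_num) hlow.le
    linarith [this, show (3 : ℝ)⁻¹ = 1 / 3 by norm_num]
  have hu3 : u ^ 3 ≤ 1 := by
    calc u ^ 3 ≤ (1 / 3 : ℝ) ^ 3 := pow_le_pow_left₀ hupos.le hu1 3
      _ ≤ 1 := by norm_num
  have hu5 : 0 ≤ u ^ 5 := by positivity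
  -- |14u⁸ − 8u⁵| ≤ 8u⁵
  have habs : |14 * u ^ 8 - 8 * u ^ 5| ≤ 8 * u ^ 5 := by
    rw [abs_le]
    constructor
    · nlinarith [pow_nonneg hupos.le 8]
    · have : u ^ 8 = u ^ 5 * u ^ 3 := by ring
      nlinarith [mul_le_mul_of_nonneg_left hu3 hu5]
  -- 8u⁵ ≤ 8 (αQ/36)⁻⁵ ≤ (1611/100)(36/Q)⁵
  have hpow : u ^ 5 ≤ ((4347 / 5000 * (Q / 36))⁻¹) ^ 5 := pow_le_pow_left₀ hupos.le hule 5
  have hval : ((4347 / 5000 * (Q / 36))⁻¹) ^ 5 = (5000 / 4347) ^ 5 * (36 / Q) ^ 5 := by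
    rw [mul_inv, mul_pow]
    congr 1
    · norm_num
    · rw [inv_div]
  have hQ5 : 0 ≤ (36 / Q) ^ 5 := by positivity
  calc |14 * u ^ 8 - 8 * u ^ 5| ≤ 8 * u ^ 5 := habs
    _ ≤ 8 * ((5000 / 4347 : ℝ) ^ 5 * (36 / Q) ^ 5) := by rw [← hval]; linarith
    _ = (8 * (5000 / 4347 : ℝ) ^ 5) * (36 / Q) ^ 5 := by ring
    _ ≤ 1611 / 100 * (36 / Q) ^ 5 := mul_le_mul_of_nonneg_right (by norm_num) hQ5

/-- **The far `|ω|` bound:** on the window, for a class with `Q(c) ≥ 144` (`‖ζ⁰_c‖ ≥ 2`),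
`|ω(‖Aζ_c(δ)‖)| ≤ (1611/100)·(36/Q(c))⁵ ≈ 16.11‖ζ⁰_c‖⁻¹⁰`. [folklore] -/
theorem abs_omegaLJ_far {A : E3 →L[ℝ] E3} {δ : E3} (hW : CellWindow A) (hδ : ShiftWindow A δ) {c : BondClass}
    (hc : 144 ≤ Qint c) :
    |omegaLJ ‖A (bondVec δ c)‖| ≤ 1611 / 100 * ((36 : ℝ) / (Qint c : ℝ)) ^ 5 := by
  have hQ : (144 : ℝ) ≤ (Qint c : ℝ) := by exact_mod_cast hc
  have hQeq := qint_cast c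
  set ℓ := ‖bondVec 0 c‖ with hℓ
  have hℓ2 : 2 ≤ ℓ := by nlinarith [norm_nonneg (bondVec 0 c)]
  have hz : ℓ - 5 / 189 ≤ ‖bondVec δ c‖ := norm_bondVec_ge hW hδ c
  have hr : 189 / 200 * ‖bondVec δ c‖ ≤ ‖A (bondVec δ c)‖ := (hW _).1
  set r := ‖A (bondVec δ c)‖ with hrdef
  have hzpos : 0 ≤ ℓ - 5 / 189 := by linarith
  have hr' : 189 / 200 * (ℓ - 5 / 189) ≤ r := le_trans (by nlinarith) hr
  have hr2 : 4347 / 5000 * ((Qint c : ℝ) / 36) ≤ r ^ 2 := by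
    rw [hQeq]
    have h1 : (189 / 200 * (ℓ - 5 / 189)) ^ 2 ≤ r ^ 2 := pow_le_pow_left₀ (by positivity) hr' 2
    nlinarith
  have hω : omegaLJ r = 14 * (r ^ 2)⁻¹ ^ 8 - 8 * (r ^ 2)⁻¹ ^ 5 := by
    unfold omegaLJ
    rw [← inv_pow, ← pow_mul, ← pow_mul]
  rw [hω]
  exact far_abs_scalar hQ hr2

/-- the rational far charge `U(Q) = ⌈(1611/100)(36/Q)⁵·10⁶⌉/10⁶` (rounded up to 6 decimals). -/
def uOfQ (Q : ℤ) : ℚ := (⌈(1611 / 100 : ℚ) * (36 / (Q : ℚ)) ^ 5 * 1000000⌉ : ℚ) / 1000000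

/-- `U(Q)` dominates the exact rational bound. [folklore] -/
theorem le_uOfQ (Q : ℤ) : (1611 / 100 : ℝ) * ((36 : ℝ) / (Q : ℝ)) ^ 5 ≤ (uOfQ Q : ℝ) := by
  unfold uOfQ
  have h := Int.le_ceil ((1611 / 100 : ℚ) * (36 / (Q : ℚ)) ^ 5 * 1000000)
  have h' : (((1611 / 100 : ℚ) * (36 / (Q : ℚ)) ^ 5 * 1000000 : ℚ) : ℝ) ≤
      ((⌈(1611 / 100 : ℚ) * (36 / (Q : ℚ)) ^ 5 * 1000000⌉ : ℚ) : ℝ) := by exact_mod_cast h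
  push_cast at h' ⊢
  linarith

/-- **The far charge of a class:** `|ω(‖Aζ_c(δ)‖)| ≤ U(Q(c))` on the window for `Q(c) ≥ 144`. [folklore] -/
theorem abs_omegaLJ_le_uOfQ {A : E3 →L[ℝ] E3} {δ : E3} (hW : CellWindow A) (hδ : ShiftWindow A δ)
    {c : BondClass} (hc : 144 ≤ Qint c) : |omegaLJ ‖A (bondVec δ c)‖| ≤ (uOfQ (Qint c) : ℝ) :=
  (abs_omegaLJ_far hW hδ hc).trans (le_uOfQ (Qint c))

/-! ## Nearest-neighbour chains (a computable greedy construction; validity is CHECKED, not proved) -/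

/-- triangular-lattice graph distance of `(a, b)` from the origin with steps `±(1,0), ±(0,1), ±(1,−1)` -/
def triDist (a b : ℤ) : ℕ := (max (max |a| |b|) |a + b|).toNat

/-- one greedy in-plane step towards `(a, b)` -/
def planarStep (a b : ℤ) : ℤ × ℤ :=
  if 0 < a ∧ b < 0 then (1, -1) else if a < 0 ∧ 0 < b then (-1, 1)
  else if 0 < a then (1, 0) else if a < 0 then (-1, 0) else if 0 < b then (0, 1) else (0, -1)

/-- greedy in-plane chain on sublattice `m` realising the offset `(a, b, 0)` (fuel-bounded) -/
def planarChain (m : Fin 2) : ℕ → ℤ → ℤ → List BondClass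
  | 0, _, _ => []
  | fuel + 1, a, b =>
      if a = 0 ∧ b = 0 then []
      else
        let s := planarStep a b
        (m, m, ![s.1, s.2, 0]) :: planarChain m fuel (a - s.1) (b - s.2)

/-- the three inter-sublattice nearest-neighbour classes leaving sublattice `cur` upwards / downwards -/
def vertClasses (cur : Fin 2) (up : Bool) : List BondClass :=
  if cur = 0 then
    (if up then [(0, 1, ![0, 0, 0]), (0, 1, ![-1, 0, 0]), (0, 1, ![0, -1, 0])]
      else [(0, 1, ![0, 0, -1]), (0, 1, ![-1, 0, -1]), (0, 1, ![0, -1, -1])])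
  else
    (if up then [(1, 0, ![0, 0, 1]), (1, 0, ![1, 0, 1]), (1, 0, ![0, 1, 1])]
      else [(1, 0, ![0, 0, 0]), (1, 0, ![1, 0, 0]), (1, 0, ![0, 1, 0])])

/-- the element of a nonempty-by-default list minimising `f` (first on ties; `d` if empty) -/
def argminD (f : BondClass → ℕ) (d : BondClass) : List BondClass → BondClass
  | [] => d
  | x :: rest => let y := argminD f x rest; if f x ≤ f y then x else y

/-- greedy chain: `k` vertical steps from sublattice `cur` (accumulated integer offset `acc`), then in-plane -/
def vertChain : Fin 2 → Bool → ℕ → (Fin 3 → ℤ) → (Fin 3 → ℤ) → List BondClass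
  | cur, _, 0, acc, tgt => planarChain cur (triDist (tgt 0 - acc 0) (tgt 1 - acc 1)) (tgt 0 - acc 0) (tgt 1 - acc 1)
  | cur, up, k + 1, acc, tgt =>
      let cands := vertClasses cur up
      let s := argminD (fun s => triDist (tgt 0 - acc 0 - s.2.2 0) (tgt 1 - acc 1 - s.2.2 1)) (cands.headD (0, 0, 0)) cands
      s :: vertChain s.2.1 up k (acc + s.2.2) tgt

/-- **The nearest-neighbour chain of a class** `(m, m', n)`: `|2n₂ + s|` vertical steps, then in-plane steps. -/
def chainNN (c : BondClass) : List BondClass :=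
  let H : ℤ := 2 * c.2.2 2 + (subSignZ c.2.1 - subSignZ c.1)
  vertChain c.1 (decide (0 ≤ H)) H.natAbs 0 c.2.2

/-- the 24 nearest-neighbour classes as a list (same order as `nnClasses`) -/
def nnList : List BondClass :=
  [((0 : Fin 2), (0 : Fin 2), (![1, 0, 0] : Fin 3 → ℤ)), (0, 0, ![-1, 0, 0]), (0, 0, ![0, 1, 0]),
    (0, 0, ![0, -1, 0]), (0, 0, ![1, -1, 0]), (0, 0, ![-1, 1, 0]),
    (1, 1, ![1, 0, 0]), (1, 1, ![-1, 0, 0]), (1, 1, ![0, 1, 0]),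
    (1, 1, ![0, -1, 0]), (1, 1, ![1, -1, 0]), (1, 1, ![-1, 1, 0]),
    (0, 1, ![0, 0, 0]), (0, 1, ![-1, 0, 0]), (0, 1, ![0, -1, 0]),
    (0, 1, ![0, 0, -1]), (0, 1, ![-1, 0, -1]), (0, 1, ![0, -1, -1]),
    (1, 0, ![0, 0, 0]), (1, 0, ![1, 0, 0]), (1, 0, ![0, 1, 0]),
    (1, 0, ![0, 0, 1]), (1, 0, ![1, 0, 1]), (1, 0, ![0, 1, 1])]

/-- `nnList` enumerates `nnClasses` without repetition. [folklore] -/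
theorem nnList_nodup : nnList.Nodup := by decide

/-- `nnList` enumerates `nnClasses`. [folklore] -/
theorem nnList_toFinset : nnList.toFinset = nnClasses := by decide

/-- sums over `nnClasses` as list sums over `nnList`. [folklore] -/
theorem sum_nnClasses_eq (f : BondClass → ℝ) : ∑ c ∈ nnClasses, f c = (nnList.map f).sum := by
  rw [← nnList_toFinset, List.sum_toFinset _ nnList_nodup]

/-- Anchor of this support file (registered stub of the line skeleton): a computed chain. -/
theorem stub_certFar : chainNN (0, 0, ![2, 0, 0]) = [(0, 0, ![1, 0, 0]), (0, 0, ![1, 0, 0])] := by decide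

end Summit.AtomisticToContinuum.Crystallization.Theorems.PhononStabilityCWC.Cert

end
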